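import Summits.QuantumFields.BalabanUV.T4Continuum.Support.NE9CurChartTowerPiLatticeUniformClassW80VJ
import Summits.QuantumFields.BalabanUV.T4Continuum.Support.NE9KerChartCauchyTower

/-!
# NE9KerChartCauchyTowerPiLatticeUniformW80VJ — THE DECAY-FREE CAUCHY CORE OF THE KERNEL SPECIES `ker U` AT THE k-LEVEL `cur U` CHART OF PRINT's OPERATOR
# (3.122) WITH ONE CAUCHY RADIUS FOR EVERY HEIGHT, SPACING, PERIOD AND UNITARY BACKGROUND OF PRINT's SMALL-FIELD CLASS: (F) `Support/NE9KerChartCauchyTower`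
# §1 `kerCauchy_of_chart` (the three decay-free rows from (Ψ1)(Ψ2) of ANY chart) RE-INSTANTIATED at this seat's `Support/NE9CurChartTowerPiLatticeUniformClassW80VJ`
# (I-7-W80VJ) — whose radii `R_b, R′` precede `∀ n η m U`, so every Cauchy radius `0 < r < R_b` and every constant `M·(N∕r)ᴺ` of [Balaban1987RG1] (4.22)'s
# analyticity factor is chosen BEFORE the lattice; cell `pub-balaban`, T4-DAG §2 node U3 ∕ §6 NE9, WALL-NE9-P1 §3 (ii)∕(vii) (MODEL item O-NE9-1 (ii) «the
# kernel species `ker`»); NE9 crux-team (2) leaf prover 01 (`b2b-balaban-t4-ne9-formalise-leaf-01`, gen 97); Summits-side NEW sibling leaf under this seat's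
# INTERFACE REQUEST NE9 [NE9LEAF01-G96-IFR] (HOME/INBOX.md L.74921; ruling e34b3e0c (0)); nothing printed asserted.  W80VJ VARIANT (gen 97): the (L3) `W`-slot is the CONCRETE
(80)-current `W80 (rieszτ φ) τ U H̃_{1,k} C_k ε_C (Jcur U) Δπ` READ AT THE CELL's LETTERS (W-letter block discharged; only `(Δπ, M_Δ)` displayed) of `Literature.….B11Eq80Current`, whose (98)-letter `C₄` and radius `R′` are LATTICE-FREE by
`Literature.….B11Ineq98W80LatticeFree.exists_quadAnalytic_W80_latticeFree` (kernel route (73)→(86)); the chart is (I-7-W80VJ)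
`Support/NE9CurChartTowerPiLatticeUniformClassW80VJ.cur_chart_exists_tower_pi_of_unitary_class_lattice_uniform_W80VJ`; otherwise verbatim

HONEST FRAMING (T4-DAG PAGE 1).  Rung (B)+1 of the FINITE-VOLUME T⁴ programme — NOT infinite volume, NOT a mass gap, NOT the Clay problem.  NE9
(`T4OutputRate.NE9` ∧ `FadingMemory`) is a cell NEW ESTIMATE, NOT PRINTED in [I] = [Balaban1987RG1] (CMP **109**) ∕ [II] = [Balaban1988RG2Cluster]
(CMP **116**), NOT PROVED here («NE9 ⇐ the named binders»; spine PROVED 0∕9).  HONEST DEPENDENCY (cell line, verbatim): continuum YM on T⁴ ⇐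
BetaPertH ∧ nine spine estimates (0/9 proved); BetaPertH ⇐ (D1) ∧ (D4) ∧ CAP+tail; G-an2-4 gates asym, D1 and NE2/3/4.  The kernel species `ker`
is ONE field of the MODEL O-NE9-1 (ii); its binder (K) `kerBound` = DECAY × ANALYTICITY ([I] (4.5) p. 282, (4.22) p. 286).  THIS FILE IS THE ANALYTICITY
FACTOR with a lattice-free Cauchy radius; the decay factor ([Balaban1985Variational] (189)–(190)) is NOT here; `act` and NEEDS-COORDINATOR #5 untouched.

WHAT THIS FILE PROVES (ONE theorem; 0 def, 0 sorry, axioms standard; [folklore] composition BY NAME).  **`kerCauchy_tower_pi_of_unitary_class_lattice_uniform_W80VJ`**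
— (I-7)'s `∃ α₁ j₁ ε₄ ε_C R_b R′` BEFORE `∀ n η m U …` and its per-lattice `∃ h52 hpos′ hposπ` KEPT; then for EVERY map `Φ` that agrees with the chart
`chartHB 𝔊̃_k 0 (W80 (rieszτ φ) τ U H̃_{1,k} C_k ε_C (Jcur U) Δπ) 0 (A′ ↦ A′ + solA H̃_{1,k} 0 C_k 0 ε_C A′) ε₄ H̃_{1,k}` (print's operator at the geometric per-level profile, `QkW_surjective`): the triple
(Ψ1)–(Ψ3) for `Φ`, AND for every old term `F` holomorphic on `ball 0 R′` with `‖F‖ ≤ M` and every `0 < r < R_b` the three decay-free rows —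
`‖Dᴺ(F ∘ Φ)(0)‖ ≤ M(N∕r)ᴺ`, the every-index-tuple kernel bound `‖𝐄⁽ᴺ⁾(xs)[b]‖ ≤ M(N∕r)ᴺ∏‖b_k‖`, the volume-free bilocalized `(p, q)` bound
([Balaban1987RG1] (4.2)–(4.5), (4.19)–(4.22) p. 286).  Since `R_b` precedes the lattice, `r := R_b∕2` (say) is ONE Cauchy radius for the whole tower and class.
DISGUISE TEST: composition of two landed theorems; no inequality of the series proved; print's class, the diagonal bookkeeping, the weight-profile bounds and
the (L3) `W` stay DISPLAYED; NOT the decay factor, NOT the two-background chart, NOT claimed that Bałaban's 𝐇_k ∕ old terms meet these letters (O-NE9-1; #5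
UNRULED); `ker` NOT constructed; not NE9.
References (TYPES ∕ loci only): [Balaban1987RG1] (4.2)–(4.5) p. 282, (4.19)–(4.22) p. 286; [Balaban1985Variational] (103) p. 293, Prop. 6 (117)–(121) p. 295,
(172)–(175) p. 305; [Balaban1985BackgroundPropagators] (3.35)–(3.37) p. 396, (3.122) p. 420, Thm 3.12 p. 423, Thm 3.13 p. 426; [Balaban1985Averaging] Prop. 2 p. 26.
-/

noncomputable section

open Metric Set Finset

namespace Summit.QuantumFields.BalabanUV.T4Continuum.NE9KerChartCauchyTowerPiLatticeUniformW80VJ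

open scoped InnerProductSpace ComplexConjugate BigOperators
open Literature.MathematicalPhysics.QuantumFieldTheory.Balaban1983to89
open B11Eq103H1Complex B11Eq115Space B11Eq174Chart
open B11Eq111FrakG (nabla115)
open B13Contraction113 (QuadAnalytic)
open B9SectCLatticeCarrier (Bond bpos btgt unshift)
open B4Sect5Torus (TSite)
open B7Prop1Explicit (U1 Wcx boxVec)
open B7Prop2Explicit (pdev AvgClosed C0 c2' unitaryUnits avgClosed_unitaryUnits unitaryUnits_le_U1)
open B7Prop3Flat (c3)
open B9Eq315QTorus (perCfg cornerSite)
open B9Eq315QTower (towerP UlevOf)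
open B9Eq326OperatorTower (QkW QkW_surjective laplaceAk)
open B9Eq310HessianOperator (adTransportW)
open B9Eq310DeltaPrime (plaqHolU)
open B9Eq324DeltaPrimeATower (laplacePrimeAk)
open B9Eq3119DeltaPiTower (laplaceAkPi)
open B11Eq44COperatorTower (αT αT_le ulev_mem_U1_of_pdev)
open B11Eq44COperatorTowerGeometric (ulev_reg_of_pdev_geometric geomProfile_nonneg geomProfile_le_αT sum_geomProfile_le)
open B11Eq44CLetterTower (Cck)
open B9Thm311SmallFieldClosed (hRS_of_unitary)
open B9Eq315QTorusOnto (liftSite perSite_liftSite)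
open B7Eq43AveragedSmallnessLevelFree (pdev_perCfg_le_of_plaq)
open B7Eq43AveragedSmallnessLinearFeed (twoWindows_linear_feed)
open B9Thm311SitePrimeFormCoerciveTowerCanonical (exists_strong_site_coercive_tower_diagonal)
open B9Thm311LaplaceAkPiPositiveDiagonal (exists_laplaceAkPi_pos_diagonal_closed)
open B9Thm311LaplaceAkPositiveDiagonal (exists_laplaceAk_pos_diagonal_closed)
open B9Eq326OperatorTowerRealityUnitary (UlevOf_star_eq_inv forall_star_eq_inv_of_mem)
open B9Eq342GreenPrimeSupBound (norm_adTransportW_eq)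
open B12Eq419Kernel (kernelE)
open Summit.QuantumFields.BalabanUV.T4Continuum.NE9CurChartTowerPiLatticeUniformClassW80VJ (cur_chart_exists_tower_pi_of_unitary_class_lattice_uniform_W80VJ)
open B11Eq98V0primeCurrentSlots (rieszτ)
open B11Eq98CurrentSlot (Jcur)
open B11Eq80Current (W80)
open B11Eq63V0GroupCurrent (curV0)
open B11Eq44CLetterTower (Cck)
open Summit.QuantumFields.BalabanUV.T4Continuum.NE9KerChartCauchyTower (kerCauchy_of_chart)

variable {d : ℕ} (hd : 1 ≤ d) (L : ℕ) [NeZero L] (hL : 1 ≤ L) (hL2 : 2 ≤ L) (hL3 : 3 ≤ L) [Fact (0 < (L : ℝ))]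
  {𝔸 : Type*} [CStarAlgebra 𝔸] [Nontrivial 𝔸] [FiniteDimensional ℂ 𝔸]
  {W : Type*} [NormedAddCommGroup W] [InnerProductSpace ℂ W] [FiniteDimensional ℂ W] (φ : W ≃ₗ[ℂ] 𝔸)
  {Mφ Mφ' : ℝ} (hMφ : 0 ≤ Mφ) (hMφ' : 0 ≤ Mφ') (hφ : ∀ w, ‖φ w‖ ≤ Mφ * ‖w‖) (hφ' : ∀ X, ‖φ.symm X‖ ≤ Mφ' * ‖X‖)
  {a : ℝ} (ha : 0 < a) {a' : ℝ} (ha' : 0 < a')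
  (τ : 𝔸 →ₗ[ℂ] ℂ) {Cτ : ℝ} (hτ : ∀ X, ‖τ X‖ ≤ Cτ * ‖X‖) (hCτ : 0 ≤ Cτ) {Mτ : ℝ} (hτm : ∀ X Y : 𝔸, ‖τ (X * Y)‖ ≤ Mτ * ‖X‖ * ‖Y‖) (hMτ : 0 ≤ Mτ)
  {ρw : ℝ} (hρw : 0 ≤ ρw)
  (hτ₁ : ∀ X : 𝔸, τ (star X) = conj (τ X)) (hτ₂ : ∀ X Y : 𝔸, τ (X * Y) = τ (Y * X)) (hφτ : ∀ X Y : 𝔸, ⟪φ.symm X, φ.symm Y⟫_ℂ = τ (star X * Y))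
  {α₀ : ℝ} (hα₀ : 0 < α₀) (hα3 : C0 d * α₀ ≤ 1 / 3) (hα4 : 4 * α₀ ≤ c2' d L)
  (hαL : 50 * (d + 1) * αT d L α₀ * (L : ℝ) ^ d ≤ 1 / 2)
  {ρ : ℝ} (hρ0 : 0 < ρ) (hρ : Real.exp (4 * (800 * ((d : ℝ) + 1) ^ 2 * ((d : ℝ) + 4)) * α₀) * (1 + 8 * (131072 * ((d : ℝ) + 1) ^ 2) * ρ) ≤ 2)
  (hρ4 : 4 * ρ ≤ c3 d L) (hθ : 2 * d * B7Prop5GeneralLevels.thetaGen d L α₀ ≤ (L : ℝ) ^ 3 / 16) (hC3 : 2 * d * B7Prop5GeneralLevels.C3Gen d L * ρ ≤ 1)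
  (hCτ1 : Cτ ≤ 1) {ω Ω : ℝ} (hω1 : 1 ≤ ω) (hΩ1 : 1 ≤ Ω) {MΔ : ℝ} (hMΔ : 0 ≤ MΔ)

-- deep definitional unfolding `laplaceAkPi` ↦ `laplaceALatticeK … (π†Δπ) …` in the statement (as the host)
set_option maxRecDepth 8192 in
set_option maxHeartbeats 1600000 in -- (I-7)'s ≈ 60-binder theorem applied once + the chart term
include hd hL2 hL3 hMφ hMφ' hφ hφ' ha ha' hτ hCτ hτm hMτ hρw hτ₁ hτ₂ hφτ hα₀ hα3 hα4 hαL hρ0 hρ hρ4 hθ hC3 hCτ1 hω1 hΩ1 hMΔ in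
/-- **THE K-CORE OF `ker U` AT THE LATTICE-UNIFORM k-LEVEL CHART ON PRINT's CLASS** — (I-7) KEPT (`∃` radii before the lattice, `∃ h52 hpos′ hposπ` per lattice),
read at every `Φ` agreeing with the chart: (Ψ1)–(Ψ3) for `Φ` AND, for every old term `F` holomorphic on `ball 0 R′` bounded by `M` and every `0 < r < R_b`,
the three decay-free Cauchy rows of (F) `kerCauchy_of_chart`. [folklore]
[cite: Balaban1987RG1, (4.2)–(4.5) p.282, (4.19)–(4.22) p.286; Balaban1985BackgroundPropagators, (3.122) p.420, (3.35)–(3.37) p.396, Thm 3.13 p.426; Balaban1985Variational, (103) p.293, Prop. 6 (117)–(121) p.295, (172)–(175) p.305] -/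
theorem kerCauchy_tower_pi_of_unitary_class_lattice_uniform_W80VJ {X : Type*} [NormedAddCommGroup X] [NormedSpace ℂ X] [CompleteSpace X] :
    ∃ α₁ j₁ ε₄ εC Rb R' : ℝ, 0 < α₁ ∧ 0 < j₁ ∧ 0 < Rb ∧ 0 < R' ∧
      ∀ (n : ℕ) (η : ℝ) [Fact (0 < η)] (hηL : η * (L : ℝ) ^ (n + 1) = 1) (c₀ c₁ : ℝ) [Fact (0 < c₀)] [Fact (0 < c₁)]
        (_hw : c₀ * ((L : ℝ) ^ (n + 1)) ^ d = c₁) (_hc₀η : c₀ = η ^ d) (_hρ : |η| ^ d / c₀ ≤ ρw) (m : Fin d → ℕ) [∀ i, NeZero (m i)] (_hm : ∀ i, 1 ≤ m i)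
        (U : Bond d (towerP L m (n + 1)) → 𝔸ˣ) (hUG : ∀ (x : B7Prop1Explicit.Site d) (κ : Fin d), perCfg (towerP L m (n + 1)) U x κ ∈ unitaryUnits 𝔸)
        (α : ℝ) (_hα : 0 ≤ α) (_hαle : α ≤ α₁) (_hUη : ∀ b, ‖(U b : 𝔸) - 1‖ ≤ α * η)
        (_hpl : ∀ p : B9SectCLatticeCarrier.Plaq d (towerP L m (n + 1)), ‖(plaqHolU U p : 𝔸) - 1‖ ≤ α * η ^ 2)
        (_hUgrad : ∀ (x : TSite d (towerP L m (n + 1))) (μ : Fin d), ‖(U (x, μ) : 𝔸) - U (unshift μ x, μ)‖ ≤ α * η ^ 2)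
        (j₀ : ℝ) (_hJ : ∀ μ y, ‖B9Eq39Adjoint.J (fun μ => B9Eq33CovDerivVector.shiftEquiv μ) (fun μ y => U (y, μ)) η μ y‖ ≤ j₀) (_hj : j₀ ≤ j₁)
        (lev₀ : Bond d (towerP L m (n + 1)) → ℕ) (lev₁ : Bond d (towerP L m (n + 1)) × Fin d → ℕ) (levB : Bond d m → ℕ) (_hlev : ∀ b, n + 1 ≤ lev₀ b)
        (_hw₀ : (NegSup.wSup (levWeight (L : ℝ) η lev₀ 1) : ℝ) ≤ ω) (_hw₁ : (NegSup.wSup (levWeight (L : ℝ) η lev₁ 2) : ℝ) ≤ ω)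
        (_hw₃ : (NegSup.wInvSup (levWeight (L : ℝ) η lev₀ 3) : ℝ) ≤ Ω) (_hwB : (NegSup.wInvSup (levWeight (L : ℝ) η levB 0) : ℝ) ≤ Ω)
        (_hw₁' : (NegSup.wInvSup (levWeight (L : ℝ) η lev₁ 2) : ℝ) ≤ Ω)
        (Δπ : Space115 (L : ℝ) η lev₀ lev₁ (nabla115 η U) →L[ℂ] NegSize (L : ℝ) η lev₀ 3 𝔸) (_hΔn : ‖Δπ‖ ≤ MΔ),
      ∃ h52 : pdev (perCfg (towerP L m (n + 1)) U) < α₀ * (((L : ℝ) ^ (n + 1))⁻¹) ^ 2,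
      ∃ hpos' : ∀ x : SiteL2K ℂ d (towerP L m (n + 1)) c₀ W, x ≠ 0 →
          0 < RCLike.re ⟪x, laplacePrimeAk L m n φ η U a' (c₁ := c₁) x⟫_ℂ,
      ∃ hposπ : ∀ x : BondL2K ℂ d (towerP L m (n + 1)) c₀ W, x ≠ 0 →
          0 < RCLike.re ⟪x, laplaceAkPi L m n φ τ η U a' hpos' hL (fun j => αT d L α₀ * (((L : ℝ) ^ min (j + 1) (n + 1))⁻¹) ^ 2)
            (fun j => (geomProfile_le_αT (d := d) L (n + 1) hL hα₀.le j).trans (αT_le hL hα4))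
            (ulev_mem_U1_of_pdev L m (n + 1) U hL2 (avgClosed_unitaryUnits d L) hUG hα₀ hα3 hα4 h52)
            (ulev_reg_of_pdev_geometric L m (n + 1) U hL2 (avgClosed_unitaryUnits d L) hUG hα₀ hα3 hα4 h52) (c₁ := c₁) a x⟫_ℂ,
      ∀ (Φ : NegSize (L : ℝ) η levB 0 𝔸 → Space115 (L : ℝ) η lev₀ lev₁ (nabla115 η U)),
        Φ = (chartHB (frakGLatticeCLM (lev₀ := lev₀) φ hposπ
              (QkW_surjective L m n φ U hL _ _ _ _ fun j => le_trans (mul_le_mul_of_nonneg_right (mul_le_mul_of_nonneg_left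
                (geomProfile_le_αT (d := d) L (n + 1) hL hα₀.le j) (by positivity)) (by positivity)) hαL) lev₁ (nabla115 η U))
            0 (W80 (rieszτ φ) (LinearMap.toContinuousLinearMap τ) U (H1LatticeCLM (lev₀ := lev₀) (levB := levB) φ hposπ
              (QkW_surjective L m n φ U hL _ _ _ _ fun j => le_trans (mul_le_mul_of_nonneg_right (mul_le_mul_of_nonneg_left
                (geomProfile_le_αT (d := d) L (n + 1) hL hα₀.le j) (by positivity)) (by positivity)) hαL) lev₁ (nabla115 η U))
              (Cck L m η (n + 1) U lev₀ lev₁ (nabla115 η U) levB) εC (Jcur (L := (L : ℝ)) (η := η) (lev₀ := lev₀) U) Δπ) 0 (fun A' => A' + solA (H1LatticeCLM (lev₀ := lev₀) (levB := levB) φ hposπ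
              (QkW_surjective L m n φ U hL _ _ _ _ fun j => le_trans (mul_le_mul_of_nonneg_right (mul_le_mul_of_nonneg_left
                (geomProfile_le_αT (d := d) L (n + 1) hL hα₀.le j) (by positivity)) (by positivity)) hαL) lev₁ (nabla115 η U)) 0
              (Cck L m η (n + 1) U lev₀ lev₁ (nabla115 η U) levB) 0 εC A') ε₄
            (H1LatticeCLM (lev₀ := lev₀) (levB := levB) φ hposπ
              (QkW_surjective L m n φ U hL _ _ _ _ fun j => le_trans (mul_le_mul_of_nonneg_right (mul_le_mul_of_nonneg_left
                (geomProfile_le_αT (d := d) L (n + 1) hL hα₀.le j) (by positivity)) (by positivity)) hαL) lev₁ (nabla115 η U))) →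
        (DifferentiableOn ℂ Φ (ball (0 : NegSize (L : ℝ) η levB 0 𝔸) Rb) ∧
          MapsTo Φ (ball (0 : NegSize (L : ℝ) η levB 0 𝔸) Rb) (ball (0 : Space115 (L : ℝ) η lev₀ lev₁ (nabla115 η U)) R') ∧ Φ 0 = 0) ∧
        ∀ (F' : Space115 (L : ℝ) η lev₀ lev₁ (nabla115 η U) → X) (M : ℝ), DifferentiableOn ℂ F' (ball 0 R') → (∀ y ∈ ball (0 : Space115 (L : ℝ) η lev₀ lev₁ (nabla115 η U)) R', ‖F' y‖ ≤ M) →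
        ∀ (r : ℝ), 0 < r → r < Rb →
          (∀ N : ℕ, ‖iteratedFDeriv ℂ N (F' ∘ Φ) 0‖ ≤ M * ((N : ℝ) / r) ^ N) ∧
          (∀ (N : ℕ) (xs : Fin N → Bond d m) (b : Fin N → 𝔸),
            ‖kernelE (𝕜 := ℂ) N (F' ∘ Φ ∘ (NegSup.continuousLinearEquiv ℂ (levWeight (L : ℝ) η levB 0) (V := 𝔸)).symm) 0 xs b‖ ≤
              M * ((N : ℝ) / r) ^ N * ∏ k, ‖b k‖) ∧
          (∀ (δB B B' : Bond d m → 𝔸) (p q : Bond d m),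
            ‖∑ x₁, ∑ x₂, kernelE (𝕜 := ℂ) 4 (F' ∘ Φ ∘ (NegSup.continuousLinearEquiv ℂ (levWeight (L : ℝ) η levB 0) (V := 𝔸)).symm) 0 ![p, x₁, x₂, q]
                ![δB p, B x₁, B x₂, B' q]‖ ≤ M * ((4 : ℝ) / r) ^ 4 * (‖δB p‖ * ‖B‖ ^ 2 * ‖B' q‖)) := by
  classical
  obtain ⟨α₁, j₁, ε₄, εC, Rb, R', hα₁, hj₁, hRb0, hR'0, HC⟩ :=
    cur_chart_exists_tower_pi_of_unitary_class_lattice_uniform_W80VJ hd L hL hL2 hL3 φ hMφ hMφ' hφ hφ' ha ha' τ hτ hCτ hτm hMτ hρw hτ₁ hτ₂ hφτ hα₀ hα3 hα4 hαL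
      hρ0 hρ hρ4 hθ hC3 hCτ1 hω1 hΩ1 hMΔ
  refine ⟨α₁, j₁, ε₄, εC, Rb, R', hα₁, hj₁, hRb0, hR'0, ?_⟩
  intro n η _ hηL c₀ c₁ _ _ hw hc₀η hρ' m _ hm U hUG α hα0 hαle hUη hpl hUgrad j₀ hJ hj' lev₀ lev₁ levB hlev hw₀ hw₁ hw₃ hwB hw₁' Δπ hΔn
  obtain ⟨h52, hpos', hposπ, hΨ1, hΨ2, hΨ3⟩ :=
    HC n η hηL c₀ c₁ hw hc₀η hρ' m hm U hUG α hα0 hαle hUη hpl hUgrad j₀ hJ hj' lev₀ lev₁ levB hlev hw₀ hw₁ hw₃ hwB hw₁' Δπ hΔn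
  refine ⟨h52, hpos', hposπ, fun Φ hΦ => ?_⟩
  subst hΦ
  exact ⟨⟨hΨ1, hΨ2, hΨ3⟩, fun F' M hF hM r hr hrR => kerCauchy_of_chart (L := (L : ℝ)) (η := η) (lev := levB) hΨ1 hΨ2 hF hM hr hrR⟩

end Summit.QuantumFields.BalabanUV.T4Continuum.NE9KerChartCauchyTowerPiLatticeUniformW80VJ

end
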